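import Summits.HodgeConjecture.HodgeConjecture.Theorems.HeckePrymWeilWeilTwelvefoldsSqrtMinus7AimingArithmetic

/-!
# `AimedDescending` (stmt-HodgeConjecture-14643) · III · the aiming arithmetic for every `d > 0`

Route `HeckePrymWeil`, support item `AimedDescending`. The AIMING of the partner surface in the
printed proof (Schoen 1998 §10 "choose `f'` with `f' f_A = f`"; Markman, arXiv:2509.23403 §11.5
Step 2; van Geemen 1994, 5.2–5.4) is pure arithmetic of Hermitian forms over `K = ℚ(√-d)`: a
Weil–Hermitian space `(V, H)` of signature `(n, n)` (the `H₁` of the Weil `2n`-fold) becomes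
HYPERBOLIC — acquires a totally isotropic `K`-subspace of dimension `n + 1` — after adding the
binary space `⟨m₁ r₁⟩ ⊥ ⟨-m₂ r₂⟩` (the `H₁` of the CM Weil surface `E₀ × E₀` with polarisation
weights `(m₁, m₂)`) for suitable positive integers `m₁, m₂`, whatever the prescribed rationals
`r₁, r₂` of the same sign.

The tree already holds this for `d = 7` as the registered stub
`WeilTwelvefoldsSqrtMinus7.AmnesicSecantSheaves.stub_aimingArithmetic`
(`Theorems/HeckePrymWeilWeilTwelvefoldsSqrtMinus7AimingArithmetic`, shared verbatim with crux 1260's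
line), whose lemmas are stated for general `d > 0`. This file records the general-`d` statement
`aimingArithmetic` that item 14643 (general `p ≡ 3 (4)`) needs, DERIVED from those lemmas
(`exists_lagrangian_sum`, `exists_lagrangian_zero`, `exists_nat_mul_eq_sq_mul`,
`exists_nat_mul_eq_nat_mul`) and the tree's pre-splitting `Motives.exists_weil_presplitting`
(van Geemen 5.4 via Meyer) — the landed proof with `7 ↦ d`, nothing re-developed.
-/

noncomputable section

-- every declaration of this problem lives in `Summit.HodgeConjecture.HodgeConjecture.…`
set_option linter.dupNamespace false

open Module
open Literature.AlgebraicGeometry.Motives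

namespace Summit.HodgeConjecture.HodgeConjecture.Theorems

open WeilTwelvefoldsSqrtMinus7.AmnesicSecantSheaves

/-- **The aiming arithmetic for every `d > 0` (Landherr's lever `δ² = 1`).** Let `K ∋ α`,
`α² = -d` (`d > 0`), `K = ℚ + ℚ α`; `V` a `K`-space of dimension `2n`; `E` an alternating
`ℚ`-bilinear form on `V` of Weil type (`E(α x, α y) = d E(x, y)`) whose Hermitian form
`H(x, y) = E(x, α y) + α E(x, y)` (van Geemen 5.2 (2)) has SIGNATURE `(n, n)` (`V ⊇ P, N` definite
of dimension `n`, `P ⊓ N = 0`). Then for all rationals `r₁, r₂` of the same sign there are positive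
integers `m₁, m₂` such that the orthogonal sum of `E` and the binary Weil form
`⟨m₁ r₁⟩ ⊥ ⟨-m₂ r₂⟩` on `K²` (`Motives.diagWeilForm`, `Motives.bilinOrthSum`: the `H₁` of the
product with the CM Weil surface `E₀ × E₀` of polarisation weights `(m₁, m₂)`) is HYPERBOLIC:
`V × K²` contains a `K`-subspace of dimension `n + 1` on which the summed form vanishes
identically. Proof = the landed `stub_aimingArithmetic` with `7 ↦ d`: for `n ≥ 1` pre-split
`V ⊇ Hyp^{n-1} ⊥ ⟨a⟩ ⊥ ⟨-b⟩` (`Motives.exists_weil_presplitting`) and take `m₂ r₂ ≡ a`,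
`m₁ r₁ ≡ b` modulo squares (`exists_nat_mul_eq_sq_mul`, `exists_lagrangian_sum`); for `n = 0`,
`m₁ r₁ = m₂ r₂` (`exists_nat_mul_eq_nat_mul`, `exists_lagrangian_zero`); `H`-isotropy is
`E`-isotropy (`Motives.apply_eq_zero_of_weilHermitianForm_eq_zero`). Schoen 1998 §10; Markman
arXiv:2509.23403 §11.5 Step 2; van Geemen 1994, 5.2–5.4; Deligne–Milne 1982 Cor. 4.2. -/
theorem aimingArithmetic {K : Type} [Field K] [Algebra ℚ K] {α : K} {d : ℚ} (hd : 0 < d)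
    (hα : α * α = algebraMap ℚ K (-d))
    (hK : ∀ k : K, ∃ a b : ℚ, k = algebraMap ℚ K a + algebraMap ℚ K b * α)
    (V : Type) [AddCommGroup V] [Module ℚ V] [Module K V] [IsScalarTower ℚ K V]
    [Module.Finite K V] (n : ℕ) (hV : finrank K V = 2 * n)
    (E : LinearMap.BilinForm ℚ V) (hE : ∀ x y : V, E x y = -E y x)
    (hW : ∀ x y : V, E (α • x) (α • y) = d * E x y)
    (hPN : ∃ P N : Submodule K V, finrank K P = n ∧ finrank K N = n ∧ P ⊓ N = ⊥ ∧
      (∀ x ∈ P, x ≠ 0 → 0 < E x (α • x)) ∧ (∀ x ∈ N, x ≠ 0 → E x (α • x) < 0))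
    (r₁ r₂ : ℚ) (hr : 0 < r₁ * r₂) :
    ∃ m₁ m₂ : ℕ, 0 < m₁ ∧ 0 < m₂ ∧
      ∃ L : Submodule K (V × (Fin 2 → K)), finrank K L = n + 1 ∧
        ∀ x ∈ L, ∀ y ∈ L,
          bilinOrthSum E (diagWeilForm hd hα hK (Pi.basisFun K (Fin 2))
            ![(m₁ : ℚ) * r₁, -((m₂ : ℚ) * r₂)]) x y = 0 := by
  -- `H`-isotropy gives `E`-isotropy
  have key : ∀ (c : Fin 2 → ℚ) (L : Submodule K (V × (Fin 2 → K))),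
      (∀ x ∈ L, ∀ y ∈ L, weilHermitianForm
        (bilinOrthSum E (diagWeilForm hd hα hK (Pi.basisFun K (Fin 2)) c)) α x y = 0) →
      ∀ x ∈ L, ∀ y ∈ L,
        bilinOrthSum E (diagWeilForm hd hα hK (Pi.basisFun K (Fin 2)) c) x y = 0 :=
    fun c L h x hx y hy => apply_eq_zero_of_weilHermitianForm_eq_zero _ hd hα (h x hx y hy)
  rcases Nat.eq_zero_or_pos n with rfl | hn
  · obtain ⟨m₁, m₂, hm₁, hm₂, hm⟩ := exists_nat_mul_eq_nat_mul hr
    obtain ⟨L, hL, hiso⟩ := exists_lagrangian_zero hd hα hK E hE hW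
      ![(m₁ : ℚ) * r₁, -((m₂ : ℚ) * r₂)] (by simp [hm])
    exact ⟨m₁, m₂, hm₁, hm₂, L, hL, key _ L hiso⟩
  · obtain ⟨L, p, q, hL, hLL, hLp, hLq, hpq, hp, hq⟩ :=
      exists_weil_presplitting hd hα hK n hn V hV E hE hW hPN
    rcases mul_pos_iff.1 hr with ⟨hr₁, hr₂⟩ | ⟨hr₁, hr₂⟩
    · -- `r₁, r₂ > 0`: `e₀` positive, `e₁` negative
      obtain ⟨m₁, hm₁, t, ht⟩ := exists_nat_mul_eq_sq_mul (neg_pos.2 hq) hr₁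
      obtain ⟨m₂, hm₂, s, hs⟩ := exists_nat_mul_eq_sq_mul hp hr₂
      obtain ⟨L₂, hL₂, hiso⟩ := exists_lagrangian_sum hd hα hK E hE hW hn hL hLL hLp hLq hpq
        ![(m₁ : ℚ) * r₁, -((m₂ : ℚ) * r₂)] (i := 0) (j := 1) zero_ne_one s t
        (by simp only [Matrix.cons_val_one, Matrix.cons_val_zero]; linarith)
        (by simp only [Matrix.cons_val_zero]; linarith)
      exact ⟨m₁, m₂, hm₁, hm₂, L₂, hL₂, key _ L₂ hiso⟩
    · -- `r₁, r₂ < 0`: `e₀` negative, `e₁` positive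
      obtain ⟨m₁, hm₁, s, hs⟩ := exists_nat_mul_eq_sq_mul hp (neg_pos.2 hr₁)
      obtain ⟨m₂, hm₂, t, ht⟩ := exists_nat_mul_eq_sq_mul (neg_pos.2 hq) (neg_pos.2 hr₂)
      obtain ⟨L₂, hL₂, hiso⟩ := exists_lagrangian_sum hd hα hK E hE hW hn hL hLL hLp hLq hpq
        ![(m₁ : ℚ) * r₁, -((m₂ : ℚ) * r₂)] (i := 1) (j := 0) one_ne_zero s t
        (by simp only [Matrix.cons_val_zero]; linarith)
        (by simp only [Matrix.cons_val_one, Matrix.cons_val_zero]; linarith)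
      exact ⟨m₁, m₂, hm₁, hm₂, L₂, hL₂, key _ L₂ hiso⟩

end Summit.HodgeConjecture.HodgeConjecture.Theorems

end
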